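import Mathlib.Analysis.SpecialFunctions.Pow.Real
import Literature.MathematicalPhysics.QuantumLattice.HubbardModel
import Literature.MathematicalPhysics.QuantumLattice.FinDimSpectrum
import HarnessLib

/-!
# Weak-coupling 2D Hubbard model at low density down to `T ≥ e^{-c/|U|}`
(Benfatto–Giuliani–Mastropietro 2006), the rigorous Fermi-liquid frontier

Trunk T-QLATTICE (Literature/MathematicalPhysics/QuantumLattice); cite item `wi-03678` (route
HubbardSuperconductivity/WeakCouplingBCS, crux #4).

**Benfatto–Giuliani–Mastropietro 2006, Thm. 1.1** (Ann. Henri Poincaré 7, 809): for the Hubbard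
model on `ℤ²`, `H = Σ a⁺(-Δ/2 - μ)a⁻ + U Σ n↑ n↓` (dispersion `2 - cos k₁ - cos k₂`, half filling at
`μ = 2`), with chemical potential `0 < μ < μ₀ := (2 - √2)/2` — density well BELOW half filling, near
the band bottom (small, nearly circular Fermi curve; §1.3: smallness of `μ` is needed to control
umklapp) — and inverse temperatures `β⁻¹ ≥ e^{-a/|U|}`, there is `U₀ > 0` such that for
`|U| ≤ U₀` the infinite-volume two-point Schwinger function has the Fermi-liquid structure
(1.10)–(1.12) of loc. cit.: `Ŝ(k) = [ -i k₀ Z + v_F (|k'| - p_F) ]⁻¹ (1 + R(k))` near the Fermi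
surface with REAL, temperature-independent renormalised parameters `Z = 1 + O(U²)`, `v_F`, `p_F`
and a remainder `R` bounded as in (1.12). BGM stress (abstract, pp. 2–3) that the convergent
resummed expansion is NOT a power series in `U`: no analyticity in `U` is asserted.
Feldman–Knörrer–Trubowitz 2004 (Thms. I.4–I.5) prove a `T = 0` Fermi liquid for a class of
ASYMMETRIC dispersion relations suppressing the Cooper channel. Neither reaches the superconducting
scale `exp(-C/U²)`; this is the rigorous frontier under the route's crux #4.

## What is vendored (faithful, typeable part)

The tree has honest finite-volume Gibbs states of the Hubbard Hamiltonian on tori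
(`hubbardTorusWith 2 L 1 U μ`, `thermalCorr β H A B = tr(e^{-βH} A B)/Z`, `FinDimSpectrum.lean`),
but no infinite-volume fermionic Schwinger functions, self-energy or renormalisation constants, so
the structure (1.10)–(1.12) is recorded in prose only. The typeable shadow vendored as the named
fact `bgm_two_point_limit` is deliberately WEAKER than Thm. 1.1: in BGM's regime — REAL coupling
`|U| ≤ U₀` and `β ≤ e^{c/|U|}` — the finite-volume equal-time thermal two-point functions
`⟨c†_{xσ} c_{yσ'}⟩_{β,L}` converge as `L → ∞` (existence of the infinite-volume state that
Thm. 1.1 describes; the `L → ∞` limit at fixed `β` is part of the construction, loc. cit. §2).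
No analyticity, no disc in `ℂ`.

**Conversion of conventions.** BGM's one-body operator `-Δ/2 - μ_BGM` has hopping amplitude `1/2`
and dispersion `2 - cos k₁ - cos k₂ - μ_BGM`; the tree's `hubbardTorusWith 2 L 1 U μ` has hopping
`t = 1`, dispersion `-2(cos k₁ + cos k₂) - μ` (band `[-4, 4]`, half filling at `μ = 0`) and the same
on-site `U n↑ n↓`. Thus `H_BGM(μ_BGM, U_BGM) = ½ · H_tree(μ, U)` with `μ = 2 μ_BGM - 4`,
`U = 2 U_BGM`, and `e^{-β_BGM H_BGM} = e^{-(β_BGM/2) H_tree}` (so `β_tree = β_BGM / 2`); the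
factors of `2` in `U` and `β` are absorbed into the existential constants `U₀, c` (shrink `U₀` so
that `e^{c/|U|} ≥ 2`). BGM's hypothesis `0 < μ_BGM < (2 - √2)/2` becomes
`-4 < μ < -2 - √2` in the tree's convention, which is exactly the range quantified in
`bgm_two_point_limit` (constants allowed to depend on `μ`, weaker than BGM's uniformity). The
particle–hole mirror range `(2 + √2, 4)` is NOT included (the paper does not state it).

## Sources

* G. Benfatto, A. Giuliani, V. Mastropietro, *Fermi liquid behavior in the 2D Hubbard model at low
  temperatures*, Ann. Henri Poincaré 7 (2006) 809–898, Thm. 1.1.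
* J. Feldman, H. Knörrer, E. Trubowitz, *A two dimensional Fermi liquid*, CMP 247 (2004), Thms.
  I.4–I.5.
-/

noncomputable section

open Filter Topology Matrix
open Literature.MathematicalPhysics.QuantumLattice Literature.Probability.LatticeModels

namespace Literature.MathematicalPhysics.QuantumLattice

/-- The finite-volume thermal two-point function `⟨c†_{xσ} c_{yσ'}⟩_{β,L}` of the 2D Hubbard model
(hopping `1`, interaction `U`, chemical potential `μ`) on the torus `(ℤ/Lℤ)²`, at fixed lattice
sites `x, y ∈ ℤ²` projected to the torus (junk `0` for `L = 0`).
[Benfatto–Giuliani–Mastropietro 2006, §1 (Schwinger functions, finite volume with periodic b.c.)] [cite: BenfattoGiulianiMastropietro2006, §1] -/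
def hubbardThermalTwoPoint (β U μ : ℝ) (L : ℕ) (x y : Site 2) (σ σ' : Fin 2) : ℂ :=
  if hL : L = 0 then 0
  else
    haveI : NeZero L := ⟨hL⟩
    thermalCorr β (hubbardTorusWith 2 L 1 U μ)
      (creation (orb (FermionTorus.ofTorusSite (Torus.proj L x)) σ))
      (annihilation (orb (FermionTorus.ofTorusSite (Torus.proj L y)) σ'))

/-- **Benfatto–Giuliani–Mastropietro 2006, Thm. 1.1 — typeable shadow (existence of the
infinite-volume state in the BGM regime).** For the 2D Hubbard model with n.n. hopping `t = 1` and
chemical potential `-4 < μ < -2 - √2` (BGM's `0 < μ_BGM < (2-√2)/2` in their normalisation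
`-Δ/2 - μ_BGM`: low density near the band bottom) there are `U₀, c > 0` such that for every REAL
coupling `0 < |U| ≤ U₀` and inverse temperature `0 < β ≤ e^{c/|U|}` the finite-volume thermal
two-point functions `⟨c†_{xσ} c_{yσ'}⟩_{β,L}` converge as `L → ∞`. (Thm. 1.1 as printed asserts,
in this regime, the Fermi-liquid form (1.10)–(1.12) of the limiting Schwinger function with real
`β`-independent `Z, v_F, p_F` — prose only, see module doc; NO analyticity in `U`.)
[Benfatto–Giuliani–Mastropietro 2006, Thm. 1.1 and §2] [cite: BenfattoGiulianiMastropietro2006, Thm. 1.1] -/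
def bgm_two_point_limit : Prop :=
  ∀ μ : ℝ, -4 < μ → μ < -2 - Real.sqrt 2 → ∃ U₀ c : ℝ, 0 < U₀ ∧ 0 < c ∧
    ∀ U β : ℝ, U ≠ 0 → |U| ≤ U₀ → 0 < β → β ≤ Real.exp (c / |U|) →
      ∀ (x y : Site 2) (σ σ' : Fin 2), ∃ S : ℂ,
        Tendsto (fun L : ℕ => hubbardThermalTwoPoint β U μ L x y σ σ') atTop (𝓝 S)

/-! ### API -/

/-- The BGM temperature window is never empty: `β = 1 ≤ e^{c/|U|}` for `c > 0`. [folklore] -/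
theorem one_le_exp_div_abs {c U : ℝ} (hc : 0 < c) : (1 : ℝ) ≤ Real.exp (c / |U|) :=
  Real.one_le_exp (div_nonneg hc.le (abs_nonneg U))

/-- The admissible `μ`-range is nonempty: e.g. `μ = -7/2` (BGM's `μ_BGM = 1/4 < (2-√2)/2`). [folklore] -/
example : (-4 : ℝ) < -7/2 ∧ (-7/2 : ℝ) < -2 - Real.sqrt 2 := by
  refine ⟨by norm_num, ?_⟩
  have : Real.sqrt 2 < 3 / 2 := by
    rw [Real.sqrt_lt' (by norm_num)]; norm_num
  linarith

end Literature.MathematicalPhysics.QuantumLattice
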